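import Literature.MathematicalPhysics.QuantumFieldTheory.PeriodicBoxFreeEnergyLimits
import HarnessLib

/-!
# Crux `IR` (stmt-QuantumFields-19354), input (a) of the strong-coupling rungs: the RATE-TRACKING tail of the
# Kotecký–Preiss cluster expansion of the Wilson plaquette polymer gas, and the tube free energy with rate `τ`

Helper module for item `stmt-QuantumFields-19354` (`--supports … --as helper`; it closes nothing).  The tree's
`PlaqSystem.sum_norm_truncatedWeight_large_le` ∕ `PlaqSystem.norm_pertLogZ_sub_sum_small_le` ∕
`norm_pertLogZ_tube_sub_mul_le` ∕ `exists_tube_rate` run the Kotecký–Preiss expansion with the decay weight `d(Y) = #Y`,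
so a cluster of total size `≥ m` costs the β-INDEPENDENT factor `e^{-m}`; downstream this is the booked rate `1/4` of
`Missing.coldFreeEnergyBound_of_strongCoupling` and the rate `1/8` of `ColdPressurePincer.coldPressureAt_strongCoupling`.
Here the SAME expansion is run with the decay weight `d(Y) = τ·#Y`, `τ ≥ 1` (the abstract layer
`Literature.Probability.LatticeModels.geomInc_kp_sum_le` already carries `τ`), under the smallness
`e^{1+τ} (2M‖z‖) (D+1)² ≤ 1/2` — i.e. `τ = 1 + log(r_ρ/β)` is admissible at coupling `β ≤ r_ρ = strongCouplingRadius ρ`: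
the rate grows like `log(1/β)` as `β → 0⁺`.  This is the pattern of `StrongCouplingStringTension.lean` (vortex side) applied to
the free-energy side.  Results (all kernel-checked, no `sorry`, no new definitions):

* §1 `kp_hypothesis_card_rate`, `sum_norm_truncatedWeight_large_le_rate` (tail `≤ #W · e^{-τ m}`),
  `norm_pertLogZ_sub_sum_small_le_rate` — for a general regular plaquette system `S : PlaqSystem d G ι`;
* §2 `norm_pertLogZ_tube_sub_mul_le_rate` (`‖log Z(a³×t) − t·E_m‖ ≤ 6a³t e^{-τ m}`),
  `norm_pertLogZ_tube_div_sub_div_le_rate` (Cauchy estimate), `exists_tube_rate_rate`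
  (`‖log Z(a³×t)(z) − t e(z)‖ ≤ 12 a³ t e^{-τ⌊t/2⌋}` on `‖z‖ ≤ r`) — the four-dimensional tubes.

The sequel `StrongCouplingRateColdPressure.lean` turns this into `ColdPressureBound` at rate `τ/8`.  Used by the line
`tension-ratio` (rung T2-sc, card v1.6 note «input (a)») and offered to every pincer-currency rung on `(0, β_D]`.
HONEST FRAMING: strong-coupling bookkeeping inside `IR`'s known regime; the YM mass gap (Clay) is NOT proved by any of this;
R4 closes only the conditional finite-𝕋⁴ rung `BalabanLadder.UV`.
Refs: R. Kotecký, D. Preiss, CMP 103 (1986) 491, Theorem p. 492 (1), (2), (4); E. Seiler, LNP 159 (1982) Ch. 3;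
K. Osterwalder, E. Seiler, Ann. Phys. 110 (1978) 440 §3.
-/

set_option autoImplicit false

noncomputable section

open MeasureTheory Finset Filter Topology
open Literature.Probability.LatticeModels
open Literature.MathematicalPhysics.QuantumFieldTheory

namespace Summit.QuantumFields.YangMills.Cruxes.IR.StrongCouplingRate

/-! ## §0 Scalar helpers -/

/-- From the rate-`τ` smallness `e^{1+τ} ε (D+1)² ≤ 1/2` (`τ ≥ 1`) to the tree's two-weight smallness `e² ε (D+1)² ≤ 1/2`. -/
theorem smallness_two_of_rate {ε τ : ℝ} {D : ℕ} (hε : 0 ≤ ε) (hτ : 1 ≤ τ)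
    (h : Real.exp (1 + τ) * ε * ((D : ℝ) + 1) ^ 2 ≤ 1 / 2) :
    Real.exp 2 * ε * ((D : ℝ) + 1) ^ 2 ≤ 1 / 2 := by
  have h1 : Real.exp 2 ≤ Real.exp (1 + τ) := Real.exp_le_exp.2 (by linarith)
  have h2 : 0 ≤ ε * ((D : ℝ) + 1) ^ 2 := by positivity
  nlinarith

/-- The rate-`τ` smallness is monotone in `ε`. -/
theorem smallness_rate_mono {ε ε' τ : ℝ} {D : ℕ} (hεε' : ε ≤ ε')
    (h : Real.exp (1 + τ) * ε' * ((D : ℝ) + 1) ^ 2 ≤ 1 / 2) :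
    Real.exp (1 + τ) * ε * ((D : ℝ) + 1) ^ 2 ≤ 1 / 2 := by
  have h1 : 0 ≤ Real.exp (1 + τ) := (Real.exp_pos _).le
  have h2 : 0 ≤ ((D : ℝ) + 1) ^ 2 := by positivity
  nlinarith [mul_le_mul_of_nonneg_left hεε' h1]

/-- The geometric rate `c · e^{-τ⌊(k+1)/2⌋}` tends to zero (`τ > 0`). -/
theorem tendsto_exp_neg_rate_half_floor (c : ℝ) {τ : ℝ} (hτ : 0 < τ) :
    Tendsto (fun k : ℕ => c * Real.exp (-(τ * (((k + 1) / 2 : ℕ) : ℝ)))) atTop (𝓝 0) := by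
  have h : Tendsto (fun k : ℕ => τ * (((k + 1) / 2 : ℕ) : ℝ)) atTop atTop := by
    refine Tendsto.const_mul_atTop hτ ?_
    refine tendsto_natCast_atTop_atTop.comp ?_
    refine Filter.tendsto_atTop_atTop.2 fun b => ⟨2 * b, fun k hk => ?_⟩
    omega
  have := (Real.tendsto_exp_neg_atTop_nhds_zero.comp h).const_mul c
  simpa using this

/-- Monotonicity of the rate-`τ` error in the index (`τ ≥ 0`). -/
theorem exp_neg_rate_floor_half_le {N k : ℕ} {τ : ℝ} (hτ : 0 ≤ τ) (h : N ≤ k) :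
    Real.exp (-(τ * ((k / 2 : ℕ) : ℝ))) ≤ Real.exp (-(τ * ((N / 2 : ℕ) : ℝ))) := by
  apply Real.exp_le_exp.2
  have : N / 2 ≤ k / 2 := Nat.div_le_div_right h
  have : ((N / 2 : ℕ) : ℝ) ≤ ((k / 2 : ℕ) : ℝ) := by exact_mod_cast this
  nlinarith

/-! ## §1 The tail of the cluster expansion with decay weight `d(Y) = τ·#Y` -/

section Tail

variable {d : ℕ} {G : Type*} {ι : Type*} {S : PlaqSystem d G ι} {M : ℝ} {D : ℕ}
variable [Group G] [TopologicalSpace G] [IsTopologicalGroup G] [CompactSpace G] [MeasurableSpace G]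
  [BorelSpace G] [DecidableEq ι] [Fintype ι]

/-- **The Kotecký–Preiss hypothesis (1) with `a(Y) = #Y`, `d(Y) = τ·#Y`** for the polymer functional of a regular plaquette
system on the disc `e^{1+τ} ε (D+1)² ≤ 1/2`, `ε = 2M‖β‖` (the tree's animal bound `geomInc_kp_sum_le` at weight `τ`).
Rate-tracking form of `PlaqSystem.kp_hypothesis_card_card` (`τ = 1`). -/
theorem kp_hypothesis_card_rate (hR : S.Regular M D) {β : ℂ} (hβ : ‖β‖ * M ≤ 1) {τ : ℝ}
    (hsmall : Real.exp (1 + τ) * (2 * M * ‖β‖) * ((D : ℝ) + 1) ^ 2 ≤ 1 / 2) (γ : Finset ι) :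
    Summable (fun γ' : {γ' : Finset ι // GeomInc S.Adj γ' γ} =>
        ‖connActivity S.Adj (zdHaar d G) (S.weight β) γ'‖ *
          Real.exp ((fun Y : Finset ι => (Y.card : ℝ)) γ' + (fun Y : Finset ι => τ * (Y.card : ℝ)) γ')) ∧
      ∑' γ' : {γ' : Finset ι // GeomInc S.Adj γ' γ},
        ‖connActivity S.Adj (zdHaar d G) (S.weight β) γ'‖ *
          Real.exp ((fun Y : Finset ι => (Y.card : ℝ)) γ' + (fun Y : Finset ι => τ * (Y.card : ℝ)) γ') ≤
        (fun Y : Finset ι => (Y.card : ℝ)) γ := by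
  classical
  have hε : 0 ≤ 2 * M * ‖β‖ := by have := hR.pos; positivity
  have hLP := PlaqSystem.isLocalPerturbation hR hβ
  set w := connActivity S.Adj (zdHaar d G) (S.weight β) with hw
  have hz0 : ∀ X, ¬ IsRConnected S.Adj X → w X = 0 := fun X hX => by simp [hw, connActivity, hX]
  have hz : ∀ X, ‖w X‖ ≤ (2 * M * ‖β‖) ^ X.card := fun X => by
    by_cases hX : IsRConnected S.Adj X
    · simpa [hw, connActivity, hX] using norm_cellActivity_le hLP X
    · simp only [hw, connActivity, hX, if_false, norm_zero]; exact pow_nonneg hε _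
  have hfin : ∀ γ : Finset ι, ∑ γ' ∈ Finset.univ with GeomInc S.Adj γ' γ,
      ‖w γ'‖ * Real.exp ((fun Y : Finset ι => (Y.card : ℝ)) γ' + (fun Y : Finset ι => τ * (Y.card : ℝ)) γ') ≤
        (fun Y : Finset ι => (Y.card : ℝ)) γ := by
    intro γ
    have h := geomInc_kp_sum_le (fun x y hxy => Std.Symm.symm x y (r := S.Adj) hxy) hR.card_near_le
      S.mem_near hε hsmall w hz0 hz γ (Finset.univ.filter fun Y => GeomInc S.Adj Y γ)
      fun Y hY => (Finset.mem_filter.1 hY).2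
    have h2 := two_mul_exp_mul_le_one hε hsmall
    calc ∑ γ' ∈ Finset.univ with GeomInc S.Adj γ' γ, ‖w γ'‖ * Real.exp ((γ'.card : ℝ) + τ * (γ'.card : ℝ))
        ≤ (γ.card : ℝ) * ((D : ℝ) + 1) * (2 * (Real.exp (1 + τ) * (2 * M * ‖β‖))) := h
      _ = γ.card * (((D : ℝ) + 1) * (2 * (Real.exp (1 + τ) * (2 * M * ‖β‖)))) := by ring
      _ ≤ γ.card * 1 := mul_le_mul_of_nonneg_left h2 (Nat.cast_nonneg _)
      _ = γ.card := mul_one _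
  exact kp_hypothesis_of_fintype (inc := GeomInc S.Adj) (w := w)
    (a := fun Y : Finset ι => (Y.card : ℝ)) (d := fun Y : Finset ι => τ * (Y.card : ℝ)) hfin γ

/-- **The tail of the cluster expansion with rate `τ`.**  On the disc `e^{1+τ} ε (D+1)² ≤ 1/2` (`τ ≥ 0`), the clusters of
polymers of `W` of total size `Σ_{Y ∈ 𝒞} #Y ≥ m` have total truncated weight at most `#W · e^{-τ m}` (Kotecký–Preiss (4) with
decay weight `τ·#Y`, pinned at the singletons `{p}`, `p ∈ W`).  Rate-tracking form of `PlaqSystem.sum_norm_truncatedWeight_large_le`. -/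
theorem sum_norm_truncatedWeight_large_le_rate (hR : S.Regular M D) {β : ℂ} (hβ : ‖β‖ * M ≤ 1) {τ : ℝ} (hτ : 0 ≤ τ)
    (hsmall : Real.exp (1 + τ) * (2 * M * ‖β‖) * ((D : ℝ) + 1) ^ 2 ≤ 1 / 2) (W : Finset ι) (m : ℕ) :
    ∑ 𝒞 ∈ (rconnSubsets S.Adj W).powerset with (m : ℝ) ≤ ∑ Y ∈ 𝒞, (Y.card : ℝ),
        ‖truncatedWeight (GeomInc S.Adj) (connActivity S.Adj (zdHaar d G) (S.weight β)) 𝒞‖ ≤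
      W.card * Real.exp (-(τ * m)) := by
  classical
  set L := rconnSubsets S.Adj W with hL
  set w := connActivity S.Adj (zdHaar d G) (S.weight β) with hw
  set Φ : Finset (Finset ι) → ℂ := truncatedWeight (GeomInc S.Adj) w with hΦ
  set 𝒜 : Finset (Finset (Finset ι)) := L.powerset.filter fun 𝒞 => (m : ℝ) ≤ ∑ Y ∈ 𝒞, (Y.card : ℝ)
    with h𝒜
  have ha : ∀ Y : Finset ι, 0 ≤ (fun Y : Finset ι => (Y.card : ℝ)) Y := fun _ => Nat.cast_nonneg _
  have hd : ∀ Y : Finset ι, 0 ≤ (fun Y : Finset ι => τ * (Y.card : ℝ)) Y := fun _ =>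
    mul_nonneg hτ (Nat.cast_nonneg _)
  have hfact := koteckyPreiss_truncatedWeight_bound_holds (GeomInc S.Adj) w
    (fun Y : Finset ι => (Y.card : ℝ)) (fun Y : Finset ι => τ * (Y.card : ℝ))
  have h1 := kp_hypothesis_card_rate hR hβ hsmall
  -- pin every nonempty family at a singleton `{p}`, `p ∈ W`
  have hpin : ∀ 𝒞 ∈ 𝒜, ‖Φ 𝒞‖ ≤ ∑ p ∈ W with KPTouches (GeomInc S.Adj) 𝒞 {p}, ‖Φ 𝒞‖ := by
    intro 𝒞 h𝒞
    obtain ⟨h𝒞L, -⟩ := Finset.mem_filter.1 h𝒞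
    rcases 𝒞.eq_empty_or_nonempty with rfl | hne
    · exact le_of_eq_of_le (by rw [hΦ, truncatedWeight_empty, norm_zero])
        (Finset.sum_nonneg fun _ _ => norm_nonneg _)
    · obtain ⟨p, hpW, hp⟩ := PlaqSystem.exists_mem_kpTouches_singleton (S := S) (Finset.mem_powerset.1 h𝒞L) hne
      have hmem : p ∈ W.filter fun p => KPTouches (GeomInc S.Adj) 𝒞 {p} := Finset.mem_filter.2 ⟨hpW, hp⟩
      calc ‖Φ 𝒞‖ = ∑ q ∈ ({p} : Finset ι), ‖Φ 𝒞‖ := by simp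
        _ ≤ _ := Finset.sum_le_sum_of_subset_of_nonneg (by simpa using hmem) fun _ _ _ => norm_nonneg _
  calc ∑ 𝒞 ∈ 𝒜, ‖Φ 𝒞‖
      ≤ ∑ 𝒞 ∈ 𝒜, ∑ p ∈ W with KPTouches (GeomInc S.Adj) 𝒞 {p}, ‖Φ 𝒞‖ := Finset.sum_le_sum hpin
    _ = ∑ p ∈ W, ∑ 𝒞 ∈ 𝒜 with KPTouches (GeomInc S.Adj) 𝒞 {p}, ‖Φ 𝒞‖ := by
        rw [Finset.sum_comm' (t' := W) (s' := fun p => 𝒜.filter fun 𝒞 => KPTouches (GeomInc S.Adj) 𝒞 {p})]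
        intro 𝒞 p
        simp only [Finset.mem_filter]
        tauto
    _ ≤ ∑ p ∈ W, Real.exp (-(τ * m)) * (({p} : Finset ι).card : ℝ) := by
        refine Finset.sum_le_sum fun p _ => ?_
        refine sum_norm_truncatedWeight_le_exp_neg_of_touches hfact ha hd h1 𝒜 {p} fun 𝒞 h𝒞 _ => ?_
        have hm : (m : ℝ) ≤ ∑ Y ∈ 𝒞, (Y.card : ℝ) := (Finset.mem_filter.1 h𝒞).2
        calc τ * (m : ℝ) ≤ τ * ∑ Y ∈ 𝒞, (Y.card : ℝ) := mul_le_mul_of_nonneg_left hm hτ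
          _ = ∑ Y ∈ 𝒞, τ * (Y.card : ℝ) := Finset.mul_sum _ _ _
    _ = W.card * Real.exp (-(τ * m)) := by
        simp only [Finset.card_singleton, Nat.cast_one, mul_one, Finset.sum_const, nsmul_eq_mul]

/-- **The truncated cluster expansion of `log Z` with rate `τ`.**  On the disc `e^{1+τ} ε (D+1)² ≤ 1/2` (`τ ≥ 0`):
`‖log Z(W) − Σ_{𝒞 ⊆ 𝒫(W), Σ #Y < m} Φ^T(𝒞)‖ ≤ #W · e^{-τ m}`.  Rate-tracking form of `PlaqSystem.norm_pertLogZ_sub_sum_small_le`. -/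
theorem norm_pertLogZ_sub_sum_small_le_rate (hR : S.Regular M D) {β : ℂ} (hβ : ‖β‖ * M ≤ 1) {τ : ℝ} (hτ : 0 ≤ τ)
    (hsmall : Real.exp (1 + τ) * (2 * M * ‖β‖) * ((D : ℝ) + 1) ^ 2 ≤ 1 / 2) (W : Finset ι) (m : ℕ) :
    ‖pertLogZ (zdHaar d G) (S.weight β) S.Adj W -
        ∑ 𝒞 ∈ (rconnSubsets S.Adj W).powerset with ∑ Y ∈ 𝒞, (Y.card : ℝ) < m,
          truncatedWeight (GeomInc S.Adj) (connActivity S.Adj (zdHaar d G) (S.weight β)) 𝒞‖ ≤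
      W.card * Real.exp (-(τ * m)) := by
  classical
  rw [pertLogZ_eq_sum_truncatedWeight, ← Finset.sum_filter_add_sum_filter_not (rconnSubsets S.Adj W).powerset
    (fun 𝒞 => ∑ Y ∈ 𝒞, (Y.card : ℝ) < m), add_sub_cancel_left]
  refine (norm_sum_le _ _).trans ?_
  have hset : (rconnSubsets S.Adj W).powerset.filter (fun 𝒞 => ¬ ∑ Y ∈ 𝒞, (Y.card : ℝ) < m) =
      (rconnSubsets S.Adj W).powerset.filter fun 𝒞 => (m : ℝ) ≤ ∑ Y ∈ 𝒞, (Y.card : ℝ) := by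
    simp only [not_lt]
  rw [hset]
  exact sum_norm_truncatedWeight_large_le_rate hR hβ hτ hsmall W m

end Tail

/-! ## §2 The four-dimensional tubes `a³ × t` with rate `τ` -/

section Boxes

variable {G : Type*} [Group G] [TopologicalSpace G] [IsTopologicalGroup G] [CompactSpace G]
  [MeasurableSpace G] [BorelSpace G] {N : ℕ} {ρ : G →* Matrix (Fin N) (Fin N) ℂ}

open scoped Classical in
/-- **Tubes with rate: `log Z(a³ × t) = t · E_m + O(a³ t e^{-τ m})`.**  On the disc `e^{1+τ}(2M‖z‖)(D+1)² ≤ 1/2`, `τ ≥ 1`,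
`‖z‖M ≤ 1`, for `2m ≤ t` and `m + 1 ≤ t`, the Kotecký–Preiss logarithm of the Wilson partition function of the tube `a³ × t`
differs from `t` times the time-rooted small-cluster sum `E_m` of the reference tube `a³ × (m+1)` (the SAME `E_m` as in the tree's
`norm_pertLogZ_tube_sub_mul_le`) by at most `6a³t · e^{-τ m}`. -/
theorem norm_pertLogZ_tube_sub_mul_le_rate (hρ : Continuous ρ) {z : ℂ} (hzM : ‖z‖ * costBound ρ ≤ 1) {τ : ℝ}
    (hτ : 1 ≤ τ) (hz2 : Real.exp (1 + τ) * (2 * costBound ρ * ‖z‖) * ((boxDeg 4 : ℝ) + 1) ^ 2 ≤ 1 / 2)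
    {a t m : ℕ} (ha : 0 < a) (h2m : 2 * m ≤ t) (hm1 : m + 1 ≤ t) :
    ‖pertLogZ (zdHaar 4 G) ((boxSystem (G := G) ρ (![a, a, a, t] : Fin 4 → ℕ)).weight z)
        (boxSystem (G := G) ρ (![a, a, a, t] : Fin 4 → ℕ)).Adj Finset.univ -
      (t : ℂ) * ∑ 𝒞 ∈ ((rconnSubsets (boxSystem (G := G) ρ (![a, a, a, m + 1] : Fin 4 → ℕ)).Adj
          Finset.univ).powerset.filter fun 𝒞 => ∑ Y ∈ 𝒞, (Y.card : ℝ) < m) with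
            ∀ j ∈ ({3} : Finset (Fin 4)), BoxRooted j m 𝒞,
        truncatedWeight (GeomInc (boxSystem (G := G) ρ (![a, a, a, m + 1] : Fin 4 → ℕ)).Adj)
          (connActivity (boxSystem (G := G) ρ (![a, a, a, m + 1] : Fin 4 → ℕ)).Adj (zdHaar 4 G)
            ((boxSystem (G := G) ρ (![a, a, a, m + 1] : Fin 4 → ℕ)).weight z)) 𝒞‖ ≤
      (a * a * a * t * 6 : ℝ) * Real.exp (-(τ * m)) := by
  set nt : Fin 4 → ℕ := ![a, a, a, t] with hnt
  set nr : Fin 4 → ℕ := ![a, a, a, m + 1] with hnr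
  have hR := boxSystem_regular (d := 4) (G := G) ρ hρ nt
  have hε : 0 ≤ 2 * costBound ρ * ‖z‖ := by have := costBound_pos ρ; positivity
  have hz2' : Real.exp 2 * (2 * costBound ρ * ‖z‖) * ((boxDeg 4 : ℝ) + 1) ^ 2 ≤ 1 / 2 :=
    smallness_two_of_rate hε hτ hz2
  have hz1 := PlaqSystem.smallness_one_of_two (D := boxDeg 4) hε hz2'
  have hsmall1 : Real.exp 1 * (2 * costBound ρ * ‖z‖) * ((boxDeg 4 : ℝ) + 1) ^ 2 ≤ 1 / 2 := by
    simpa [mul_comm] using hz1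
  -- tail of the cluster expansion, with rate
  have htail := norm_pertLogZ_sub_sum_small_le_rate hR hzM (le_trans zero_le_one hτ) hz2 Finset.univ m
  rw [Finset.card_univ, hnt, card_boxLabel_four] at htail
  -- translation invariance in the time direction
  have hnt3 : 2 * m ≤ nt 3 := h2m
  have hrot := sum_small_eq_size_mul_sum_of_iff (G := G) (n := nt) hρ hzM hsmall1 (3 : Fin 4) hnt3
    (fun _ => True) (fun 𝒞 => ∀ j ∈ ({3} : Finset (Fin 4)), BoxRooted j m 𝒞) (fun _ _ => Iff.rfl)
    (fun 𝒞 => by simp)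
  have ht : ((nt 3 : ℕ) : ℂ) = (t : ℂ) := rfl
  rw [Finset.filter_true, ht] at hrot
  -- independence of the length
  have hincl : ∑ 𝒞 ∈ ((rconnSubsets (boxSystem (G := G) ρ nr).Adj Finset.univ).powerset.filter
        fun 𝒞 => ∑ Y ∈ 𝒞, (Y.card : ℝ) < m) with ∀ j ∈ ({3} : Finset (Fin 4)), BoxRooted j m 𝒞,
        truncatedWeight (GeomInc (boxSystem (G := G) ρ nr).Adj)
          (connActivity (boxSystem (G := G) ρ nr).Adj (zdHaar 4 G) ((boxSystem (G := G) ρ nr).weight z)) 𝒞 =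
      ∑ 𝒞 ∈ ((rconnSubsets (boxSystem (G := G) ρ nt).Adj Finset.univ).powerset.filter
        fun 𝒞 => ∑ Y ∈ 𝒞, (Y.card : ℝ) < m) with ∀ j ∈ ({3} : Finset (Fin 4)), BoxRooted j m 𝒞,
        truncatedWeight (GeomInc (boxSystem (G := G) ρ nt).Adj)
          (connActivity (boxSystem (G := G) ρ nt).Adj (zdHaar 4 G) ((boxSystem (G := G) ρ nt).weight z)) 𝒞 :=
    sum_small_boxRooted_eq_of_le (d := 4) (G := G) hρ (tube_sizes_le hm1) ({3} : Finset (Fin 4))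
      tube_sizes_eq_of_ne (m := m) (fun i hi => by rw [Finset.mem_singleton.1 hi]; exact le_rfl)
      (tube_sizes_pos ha (Nat.succ_pos m)) z
  rw [← hincl] at hrot
  rw [← hrot]
  simpa using htail

open scoped Classical in
/-- **Tubes with rate: the Cauchy estimate** `‖log Z(a³×t)/t − log Z(a³×t')/t'‖ ≤ 12 a³ e^{-τ⌊t/2⌋}` for `1 ≤ t ≤ t'` on the
disc `e^{1+τ}(2M‖z‖)(D+1)² ≤ 1/2`, `τ ≥ 1`. -/
theorem norm_pertLogZ_tube_div_sub_div_le_rate (hρ : Continuous ρ) {z : ℂ} (hzM : ‖z‖ * costBound ρ ≤ 1) {τ : ℝ}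
    (hτ : 1 ≤ τ) (hz2 : Real.exp (1 + τ) * (2 * costBound ρ * ‖z‖) * ((boxDeg 4 : ℝ) + 1) ^ 2 ≤ 1 / 2)
    {a t t' : ℕ} (ha : 0 < a) (ht : 1 ≤ t) (htt' : t ≤ t') :
    ‖pertLogZ (zdHaar 4 G) ((boxSystem (G := G) ρ (![a, a, a, t] : Fin 4 → ℕ)).weight z)
          (boxSystem (G := G) ρ (![a, a, a, t] : Fin 4 → ℕ)).Adj Finset.univ / (t : ℂ) -
        pertLogZ (zdHaar 4 G) ((boxSystem (G := G) ρ (![a, a, a, t'] : Fin 4 → ℕ)).weight z)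
          (boxSystem (G := G) ρ (![a, a, a, t'] : Fin 4 → ℕ)).Adj Finset.univ / (t' : ℂ)‖ ≤
      12 * (a : ℝ) ^ 3 * Real.exp (-(τ * ((t / 2 : ℕ) : ℝ))) := by
  have h2m : 2 * (t / 2) ≤ t := Nat.mul_div_le t 2
  have hm1 : t / 2 + 1 ≤ t := by omega
  have h1 := norm_pertLogZ_tube_sub_mul_le_rate (G := G) hρ hzM hτ hz2 ha h2m hm1
  have h2 := norm_pertLogZ_tube_sub_mul_le_rate (G := G) hρ hzM hτ hz2 ha (h2m.trans htt') (hm1.trans htt')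
  have hs : ∀ {s : ℕ}, 1 ≤ s → (s : ℂ) ≠ 0 := fun hs => by exact_mod_cast (show _ ≠ 0 by omega)
  have hX : ∀ s : ℕ, (a * a * a * s * 6 : ℝ) * Real.exp (-(τ * ((t / 2 : ℕ) : ℝ))) =
      ‖(s : ℂ)‖ * ((a * a * a * 6 : ℝ) * Real.exp (-(τ * ((t / 2 : ℕ) : ℝ)))) := fun s => by
    rw [Complex.norm_natCast]; ring
  rw [hX] at h1 h2
  have h1' := norm_div_sub_le_of_norm_sub_mul_le (hs ht) h1
  have h2' := norm_div_sub_le_of_norm_sub_mul_le (hs (ht.trans htt')) h2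
  refine (norm_sub_le_two_mul_of_norm_sub_le h1' h2').trans (le_of_eq ?_)
  ring

open scoped Classical in
/-- **Tubes with rate: the free energy per unit length with the rate-`τ` error, uniformly on the disc `‖z‖ ≤ r`.**  For `τ ≥ 1`
and `r` with `r M ≤ 1`, `e^{1+τ}(2Mr)(D+1)² ≤ 1/2`, and every cross-section `a ≥ 1`, there is `e : ℂ → ℂ` with
`‖log Z(a³ × t)(z) − t·e(z)‖ ≤ 12 a³ t e^{-τ⌊t/2⌋}` for all `t ≥ 1`, `‖z‖ ≤ r`.  Rate-tracking form of `exists_tube_rate`. -/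
theorem exists_tube_rate_rate (hρ : Continuous ρ) {r τ : ℝ} (hτ : 1 ≤ τ) (hrM : r * costBound ρ ≤ 1)
    (hr2 : Real.exp (1 + τ) * (2 * costBound ρ * r) * ((boxDeg 4 : ℝ) + 1) ^ 2 ≤ 1 / 2) {a : ℕ} (ha : 0 < a) :
    ∃ e : ℂ → ℂ, ∀ t : ℕ, 1 ≤ t → ∀ z : ℂ, ‖z‖ ≤ r →
      ‖pertLogZ (zdHaar 4 G) ((boxSystem (G := G) ρ (![a, a, a, t] : Fin 4 → ℕ)).weight z)
          (boxSystem (G := G) ρ (![a, a, a, t] : Fin 4 → ℕ)).Adj Finset.univ - (t : ℂ) * e z‖ ≤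
        12 * (a : ℝ) ^ 3 * t * Real.exp (-(τ * ((t / 2 : ℕ) : ℝ))) := by
  have hM := costBound_pos ρ
  have hτ0 : 0 ≤ τ := le_trans zero_le_one hτ
  set u : ℕ → ℂ → ℂ := fun k z => pertLogZ (zdHaar 4 G)
    ((boxSystem (G := G) ρ (![a, a, a, k + 1] : Fin 4 → ℕ)).weight z)
    (boxSystem (G := G) ρ (![a, a, a, k + 1] : Fin 4 → ℕ)).Adj Finset.univ / ((k + 1 : ℕ) : ℂ) with hu
  set b : ℕ → ℝ := fun k => 12 * (a : ℝ) ^ 3 * Real.exp (-(τ * ((((k + 1) / 2 : ℕ) : ℝ)))) with hb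
  have hdisc : ∀ z : ℂ, ‖z‖ ≤ r → ‖z‖ * costBound ρ ≤ 1 ∧
      Real.exp (1 + τ) * (2 * costBound ρ * ‖z‖) * ((boxDeg 4 : ℝ) + 1) ^ 2 ≤ 1 / 2 := by
    intro z hz
    refine ⟨le_trans (mul_le_mul_of_nonneg_right hz hM.le) hrM, ?_⟩
    exact smallness_rate_mono (mul_le_mul_of_nonneg_left hz (by positivity)) hr2
  have hcauchy : ∀ z ∈ Metric.closedBall (0 : ℂ) r, ∀ N k k', N ≤ k → N ≤ k' → ‖u k z - u k' z‖ ≤ b N := by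
    intro z hz N k k' hk hk'
    rw [Metric.mem_closedBall, dist_zero_right] at hz
    obtain ⟨hzM, hz2⟩ := hdisc z hz
    have key : ∀ k k' : ℕ, N ≤ k → k ≤ k' → ‖u k z - u k' z‖ ≤ b N := by
      intro k k' hk hkk'
      have h : ‖u k z - u k' z‖ ≤ 12 * (a : ℝ) ^ 3 * Real.exp (-(τ * ((((k + 1) / 2 : ℕ) : ℝ)))) :=
        norm_pertLogZ_tube_div_sub_div_le_rate (G := G) hρ hzM hτ hz2 ha (t := k + 1) (t' := k' + 1)
          (by omega) (by omega)
      exact h.trans (mul_le_mul_of_nonneg_left (exp_neg_rate_floor_half_le hτ0 (by omega)) (by positivity))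
    rcases le_total k k' with h | h
    · exact key k k' hk h
    · rw [norm_sub_rev]; exact key k' k hk' h
  obtain ⟨g, hg, -⟩ := exists_tendstoUniformlyOn_of_cauchy_bound (u := u) (b := b)
    (tendsto_exp_neg_rate_half_floor _ (lt_of_lt_of_le one_pos hτ)) hcauchy
  refine ⟨g, fun t ht z hz => ?_⟩
  obtain ⟨k, rfl⟩ : ∃ k, t = k + 1 := ⟨t - 1, by omega⟩
  have h : ‖u k z - g z‖ ≤ b k := hg z (by rwa [Metric.mem_closedBall, dist_zero_right]) k
  have hk0 : ((k + 1 : ℕ) : ℂ) ≠ 0 := by exact_mod_cast (show k + 1 ≠ 0 by omega)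
  have h' := norm_sub_mul_le_of_norm_div_sub_le hk0 h
  refine h'.trans (le_of_eq ?_)
  rw [Complex.norm_natCast, hb]
  ring

end Boxes

end Summit.QuantumFields.YangMills.Cruxes.IR.StrongCouplingRate

end
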